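import Summits.CriticalPhenomena.Ising3DConformalLimit.Theses.ReflectionTwin
import HarnessLib

/-!
# Crux `ReflectionTwin.TwinTransparency` (stmt-CriticalPhenomena-16905) — birth skeleton (BC3)

Skeleton-register seat `planner-skel-stmt-CriticalPhenomena-16905-0`, 2026-08-17 (route
`route-CriticalPhenomena-ReflectionTwin`, rank-2 crux, re-audit bin REPAIRABLE).

The crux (TT, the card's TT′, BLIND form): for every bulk scaling-limit datum `(ρ, S)`
(`HasPointwiseScalingLimit (criticalCorr 3) ρ S`, `S₂ > 0`) and every continuous plane-ordering
threshold `J` of the (111) reflection twin `TW(J)` at `β_c(3)`, there is a linear `A : ℝ³ → ℝ³`,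
the identity on the plane `C = {x₀ + x₁ + x₂ = 0}` and preserving the open upper half-space, such
that for every `k` the twin `k`-point functions renormalised by `ρ(δ)^k` converge, LOCALLY UNIFORMLY
on non-coincident configurations with no point on `C`, to `S_k` of the configuration read through `A`
above the plane.

## §1 Named twin objects and the syntactic bridge (proved, `Iff.rfl`)

The route file inlines the twin as a `let` header (vertex set `ℤ³`, copy-2 site `z ↦ −z`, seam rule,
couplings `cpl`, box-sup correlator `twinLat`, continuum reading `site`/`twinCorr`, plane order
`LRO`, threshold predicate `IsSeamThreshold`). §1 names each of them verbatim (`Birth.twinCorr`, …)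
and proves `twinTransparency_iff : TwinTransparency ↔ <the crux over the named objects>` by `Iff.rfl`
(zeta/beta/delta only), so that stubs and provers can speak about `twinCorr J δ k w`.

## §2 The line: TT = (two-point blind transparency, pointwise) + (propagation to all orders,
pointwise) + (asymptotic equicontinuity of the renormalised twin correlators off the plane)

This is the route's own foreseen first split (header, TWO-LAYER PLAN: `TwinTransparency ⇐
TwinTransparencyTwo → TwinTransparencyAll`, "all k, given k = 2 and a twin version of the
mirror-Hölder regularity"), cut along the two seams that separate three different kinds of
mathematics, with the uniformity isolated as its own limit-free statement — the architecture of
route MirrorHoelderCompactness (pointwise limit PL + moduli SH/NS ⇒ locally uniform limit) transposed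
to the twin. Three registered stubs, the only `sorry`s of this file:

* `stub_twoPointTransparency` (DEFECT PHYSICS, `k = 2`, blind, POINTWISE). Under the crux's
  hypotheses there is an admissible `A` (`A = id` on `C`, `A` preserves `{h > 0}`) such that at every
  non-coincident pair `w = (w₀, w₁)` off the plane `ρ(δ)² ⟨σ_{site w₀} σ_{site w₁}⟩^{TW(J)} → S₂(A♯w)`
  as `δ → 0⁺`. The defect-RG heart of the crux at the level where it is decidable by one function of
  two points: the tuned symmetric plane defect flows to the defect-free fixed point (Bray–Moore 1977;
  Burkhardt–Eisenriegler 1981; Krishnan–Metlitski 2023 §1), so same-side AND cross-plane two-point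
  functions are asymptotically the bulk ones; the `k = 2` two-sided instance is exactly what the
  route's support `TwinTransfer` consumes to pin `A = id`. Size: open-problem.
* `stub_allOrderPropagation` (PROPAGATION IN THE ORDER, pointwise). For every admissible `A`: if the
  two-point statement above holds through `A`, then for EVERY `k` and every non-coincident `w` off
  the plane `ρ(δ)^k · twinCorr J δ k w → S_k(A♯w)`. The statement that two-point transparency of the
  seam is full transparency: in defect-CFT language, `⟨σσ⟩_defect = ⟨σσ⟩_bulk` for all pairs kills,
  through the bulk OPE `σ × σ`, every one-point function `⟨O⟩_defect` of the even sector and with it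
  the displacement operator, i.e. the defect is trivial and all bulk correlators are the bulk ones
  (Billò–Gonçalves–Lauria–Meineri, JHEP 04 (2016) 091, arXiv:1601.02883, §§2–3; Krishnan–Metlitski
  2023 §1); on the lattice it is a uniqueness statement for the twin's higher correlators given its
  two-point asymptotics (switching-lemma / random-current territory), different in kind from stub 1.
  Degenerate orders are harmless: `k = 0` gives `1 → S₀ = 1`, odd `k` gives `0 → 0` (spin flip on the
  twin; `m*(β_c(3)) = 0` for `S`). Size: XL.
* `stub_twinEquicontinuity` (LATTICE REGULARITY, limit-free). For every `k`, every non-coincident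
  `x` off the plane and `ε > 0` there is a neighbourhood `t` of `x` (within the admissible set) such
  that eventually as `δ → 0⁺`, `|ρ(δ)^k twinCorr J δ k y − ρ(δ)^k twinCorr J δ k x| ≤ ε` for all
  `y ∈ t`: asymptotic local equicontinuity of the renormalised twin correlators — "a twin version of
  the mirror-Hölder regularity" (route header). It mentions neither `S_k` as a limit nor `A`; `(ρ, S)`
  enter only as the certificate that `ρ` is the critical two-point scale. The twin keeps four
  reflection-positive mirrors (θ across `C`, FILS site-plane form, and the three diagonal lattice
  mirrors `x_i ↔ x_j`, which commute with the surgery) where `ℤ³` has nine; cf. the bulk items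
  `SeparableHoelder` / `NonSeparableModulus` / `UniformRegularity` (stmt-4658) of routes
  MirrorHoelderCompactness / ClusterRigidity. Size: L.

## §3 The composition `TwinTransparency_of` (kernel-checked, no `sorry`)

`A` from stub 1; pointwise convergence at every order through that `A` from stub 2; then the
general-topology lemma `tendstoLocallyUniformlyOn_of_forall_tendsto_of_equicontinuous` (proved here:
pointwise convergence + asymptotic local equicontinuity along a `NeBot` filter ⇒ locally uniform
convergence, an `ε/4` argument in which continuity of the limit along the set is DERIVED, not
assumed) fed with stub 3 gives the crux's `TendstoLocallyUniformlyOn` for every `k`, and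
`twinTransparency_iff` turns it into `TwinTransparency` BY NAME. Hypotheses of `TwinTransparency_of`
= the three stub statements as named propositions `Sig.stub_*` (verbatim copies);
`TwinTransparency_of_stubs` feeds the registered stubs (and thereby kernel-checks `Sig.stub_X ≡`
signature of `stub_X`).

No stub is the crux or the summit: stub 1 is `k = 2` only and pointwise; stub 2 is conditional on
stub 1's conclusion and pointwise; stub 3 asserts no limit at all. BC3 probes (stub → crux, stub →
`Ising3DConformalLimit`, stub → `¬ Ising3DConformalLimit`, by
`first | exact? | simpa using h | simpa [C] using h | (unfold C; simpa using h) | aesop`) all FAIL,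
see `BC3-probes.md` on the crux. Disproof used: none exists for this crux (`ledger crux ls
stmt-CriticalPhenomena-16905`: no workfiles before this one, 2026-08-17); the item's refuter note
(rreview-0816T21: encoding verified, `latticeApprox = floor ⇒ copy-2 sites strictly above the
lattice plane`, odd/`k ≤ 1` instances harmless, "non-vacuous iff ExistsContinuousLimit ∧
TwinThreshold") is honoured: all three stubs keep the crux's hypotheses verbatim and the same
`site`/seam encoding (§1 is definitionally the route's). Negatives index: nothing on this
sub-problem concerns twins, seams or equicontinuity of twin correlators.

References: Krishnan–Metlitski 2023 (arXiv:2301.05728) §1; Bray–Moore 1977; Burkhardt–Eisenriegler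
1981; Fröhlich–Israel–Lieb–Simon 1978 §3 (RP of the glued system); Billò–Gonçalves–Lauria–Meineri,
JHEP 04 (2016) 091 (arXiv:1601.02883) §§2–3 (defect CFT, displacement operator); Duminil-Copin, ICM
2022 §8.1, §8.4 (critical `ℤ³` correlators; scaling limit open); Friedli–Velenik 2017 §3 (GKS, free
boxes).
-/

noncomputable section

namespace Summit.CriticalPhenomena.Ising3DConformalLimit.Cruxes.TwinTransparency.Birth

open scoped BigOperators Topology Manifold Classical MeasureTheory ProbabilityTheory Matrix InnerProductSpace ComplexConjugate ContinuousMap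
open Filter Set Function TopologicalSpace MeasureTheory
open Literature.Probability.LatticeModels

/-! ## §1 The twin objects, named (verbatim the `let` header of `Theses.ReflectionTwin.TwinTransparency`) -/

/-- `ℝ³`. [folklore] -/
abbrev E : Type := EuclideanSpace ℝ (Fin 3)

/-- The normal `(1,1,1)` of the twin plane `C = {x₀ + x₁ + x₂ = 0}`. [folklore] -/
def nrm : E := EuclideanSpace.single 0 1 + EuclideanSpace.single 1 1 + EuclideanSpace.single 2 1

/-- The Euclidean reflection `θ` in the plane `C` (`θ ∉ O_h`). [folklore] -/
def θ (v : E) : E := ((ℝ ∙ nrm)ᗮ).reflection v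

/-- Lattice height `h z = z₀ + z₁ + z₂` (the (111) layer index). [folklore] -/
abbrev hZ (z : Site 3) : ℤ := z 0 + z 1 + z 2

/-- Continuum height `h v = v₀ + v₁ + v₂`. [folklore] -/
abbrev hR (v : E) : ℝ := v 0 + v 1 + v 2

/-- Twin adjacency, typed on the vertex set `ℤ³` (copy-2 site `z ↦ −z`): nearest-neighbour bonds
except those between layers `0` and `1`, replaced by the seam bonds `{x, c}`, `h x = 1`, `h c = 0`,
`x + c ∈ {e₀, e₁, e₂}`. [cite: FrohlichEtAl1978, §3] -/
abbrev Adj (a b : Site 3) : Prop :=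
  ((∑ i, |a i - b i| = 1) ∧ ¬ ((hZ a = 0 ∧ hZ b = 1) ∨ (hZ a = 1 ∧ hZ b = 0))) ∨
    (((hZ a = 0 ∧ hZ b = 1) ∨ (hZ a = 1 ∧ hZ b = 0)) ∧ ∃ i : Fin 3, a + b = Pi.single i 1)

/-- Ordered-pair couplings of the twin on the centred box `box 3 L`: `β_c(3)/2` per ordered adjacent
pair (= `β_c` per bond, bulk coupling `1`), times the seam coupling `J` on the bonds touching the
plane. [cite: FriedliVelenik2017, §3.1] -/
def cpl (J : ℝ) (L : ℕ) (a b : ↥(box 3 L)) : ℝ :=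
  if Adj a.1 b.1 then (criticalBeta 3 / 2) * (if hZ a.1 = 0 ∨ hZ b.1 = 0 then J else 1) else 0

/-- The free-box twin `k`-point function, sup over boxes (= infinite-volume limit by GKS II):
`sup_L ⟨∏ᵢ σ_{zᵢ}⟩^{TW(J)}_{box 3 L, free}`. [cite: FriedliVelenik2017, §3.1] -/
def twinLat (J : ℝ) (k : ℕ) (z : Fin k → Site 3) : ℝ :=
  ⨆ L : ℕ, PairIsing.gibbsAvg (cpl J L)
    (fun s => ∏ i, if h : z i ∈ box 3 L then spinAt (⟨z i, h⟩ : ↥(box 3 L)) s else 0)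

/-- The twin site of a continuum point at mesh `δ`: `[v/δ]` on or below the plane, the copy-2 vertex
`−[θ v/δ]` above it. [folklore] -/
def site (δ : ℝ) (v : E) : Site 3 := if hR v ≤ 0 then latticeApprox δ v else -latticeApprox δ (θ v)

/-- The twin `k`-point function of a continuum configuration at mesh `δ`. [folklore] -/
def twinCorr (J δ : ℝ) (k : ℕ) (w : Fin k → E) : ℝ := twinLat J k (fun i => site δ (w i))

/-- Plane long-range order of the twin at seam coupling `J`. [folklore] -/
def LRO (J : ℝ) : Prop := ∃ m : ℝ, 0 < m ∧ ∀ c : Site 3, hZ c = 0 → m ≤ twinLat J 2 ![0, c]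

/-- `J` is a continuous, strictly positive plane-ordering threshold of the twin (no plane LRO at `J`,
plane LRO above `J`). [folklore] -/
def IsSeamThreshold (J : ℝ) : Prop := 0 < J ∧ ¬ LRO J ∧ ∀ J' : ℝ, J < J' → LRO J'

/-- **Syntactic bridge**: the crux, verbatim, over the named twin objects (`Iff.rfl`:
zeta/beta/delta). [folklore] -/
theorem twinTransparency_iff :
    Summit.CriticalPhenomena.Ising3DConformalLimit.Theses.ReflectionTwin.TwinTransparency ↔
      ∀ (ρ : ℝ → ℝ) (S : CorrFamily 3), (∀ δ ∈ Set.Ioc (0:ℝ) 1, 0 < ρ δ) →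
        HasPointwiseScalingLimit (criticalCorr 3) ρ S → IsNondegenerateTwoPoint S →
        ∀ J : ℝ, IsSeamThreshold J →
          ∃ A : E →ₗ[ℝ] E, (∀ v, hR v = 0 → A v = v) ∧ (∀ v, 0 < hR v → 0 < hR (A v)) ∧
            ∀ k : ℕ, TendstoLocallyUniformlyOn (fun δ w => ρ δ ^ k * twinCorr J δ k w)
              (fun w => S k (fun i => if hR (w i) ≤ 0 then w i else A (w i))) (𝓝[>] (0:ℝ))
              (NonCoincident 3 k ∩ {w | ∀ i, hR (w i) ≠ 0}) :=
  Iff.rfl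

/-! ## §2 General topology: pointwise convergence + asymptotic equicontinuity ⇒ locally uniform -/

/-- **Pointwise convergence plus asymptotic local equicontinuity give locally uniform convergence.**
If `F i x → f x` for every `x ∈ s` along a proper filter `p`, and at every `x ∈ s` the family is
asymptotically equicontinuous within `s` (`∀ ε > 0, ∃ t ∈ 𝓝[s] x, ∀ᶠ i, ∀ y ∈ t, |F i y − F i x| ≤ ε`),
then `F → f` locally uniformly on `s`; continuity of `f` along `s` is derived on the way (`ε/4`).
[folklore] -/
theorem tendstoLocallyUniformlyOn_of_forall_tendsto_of_equicontinuous
    {X ι : Type*} [TopologicalSpace X] {p : Filter ι} [p.NeBot]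
    {F : ι → X → ℝ} {f : X → ℝ} {s : Set X}
    (hpt : ∀ x ∈ s, Tendsto (fun i => F i x) p (𝓝 (f x)))
    (heq : ∀ x ∈ s, ∀ ε > (0:ℝ), ∃ t ∈ 𝓝[s] x, ∀ᶠ i in p, ∀ y ∈ t, |F i y - F i x| ≤ ε) :
    TendstoLocallyUniformlyOn F f p s := by
  rw [Metric.tendstoLocallyUniformlyOn_iff]
  intro ε hε x hx
  obtain ⟨t, ht, hev⟩ := heq x hx (ε / 4) (by positivity)
  refine ⟨t ∩ s, inter_mem ht self_mem_nhdsWithin, ?_⟩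
  have hx4 : ∀ᶠ i in p, |F i x - f x| < ε / 4 := by
    have h := hpt x hx
    rw [Metric.tendsto_nhds] at h
    simpa only [Real.dist_eq] using h (ε / 4) (by positivity)
  filter_upwards [hev, hx4] with i hi hix
  rintro y ⟨hyt, hys⟩
  have hfy : |f y - f x| ≤ ε / 4 := by
    have hlim : Tendsto (fun j => |F j y - F j x|) p (𝓝 (|f y - f x|)) :=
      ((hpt y hys).sub (hpt x hx)).abs
    exact le_of_tendsto hlim (hev.mono fun j hj => hj y hyt)
  rw [Real.dist_eq]
  calc |f y - F i y| = |(f y - f x) + (f x - F i x) + (F i x - F i y)| := by congr 1; ring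
    _ ≤ |f y - f x| + |f x - F i x| + |F i x - F i y| := abs_add_three _ _ _
    _ < ε := by
        have h1 : |f x - F i x| < ε / 4 := by rw [abs_sub_comm]; exact hix
        have h2 : |F i x - F i y| ≤ ε / 4 := by rw [abs_sub_comm]; exact hi y hyt
        linarith

/-! ## §3 The stub statements as named propositions (verbatim copies of the stub signatures) -/

namespace Sig

/-- Statement of `stub_twoPointTransparency` (blind two-point transparency of the tuned twin,
pointwise). -/
def stub_twoPointTransparency : Prop :=
    ∀ (ρ : ℝ → ℝ) (S : CorrFamily 3), (∀ δ ∈ Set.Ioc (0:ℝ) 1, 0 < ρ δ) →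
      HasPointwiseScalingLimit (criticalCorr 3) ρ S → IsNondegenerateTwoPoint S →
      ∀ J : ℝ, IsSeamThreshold J →
        ∃ A : E →ₗ[ℝ] E, (∀ v, hR v = 0 → A v = v) ∧ (∀ v, 0 < hR v → 0 < hR (A v)) ∧
          ∀ w ∈ NonCoincident 3 2 ∩ {w | ∀ i, hR (w i) ≠ 0},
            Tendsto (fun δ => ρ δ ^ 2 * twinCorr J δ 2 w) (𝓝[>] (0:ℝ))
              (𝓝 (S 2 (fun i => if hR (w i) ≤ 0 then w i else A (w i))))

/-- Statement of `stub_allOrderPropagation` (two-point transparency through `A` ⇒ transparency at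
every order through `A`, pointwise). -/
def stub_allOrderPropagation : Prop :=
    ∀ (ρ : ℝ → ℝ) (S : CorrFamily 3), (∀ δ ∈ Set.Ioc (0:ℝ) 1, 0 < ρ δ) →
      HasPointwiseScalingLimit (criticalCorr 3) ρ S → IsNondegenerateTwoPoint S →
      ∀ J : ℝ, IsSeamThreshold J → ∀ A : E →ₗ[ℝ] E, (∀ v, hR v = 0 → A v = v) →
        (∀ v, 0 < hR v → 0 < hR (A v)) →
        (∀ w ∈ NonCoincident 3 2 ∩ {w | ∀ i, hR (w i) ≠ 0},
            Tendsto (fun δ => ρ δ ^ 2 * twinCorr J δ 2 w) (𝓝[>] (0:ℝ))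
              (𝓝 (S 2 (fun i => if hR (w i) ≤ 0 then w i else A (w i))))) →
        ∀ (k : ℕ), ∀ w ∈ NonCoincident 3 k ∩ {w | ∀ i, hR (w i) ≠ 0},
          Tendsto (fun δ => ρ δ ^ k * twinCorr J δ k w) (𝓝[>] (0:ℝ))
            (𝓝 (S k (fun i => if hR (w i) ≤ 0 then w i else A (w i))))

/-- Statement of `stub_twinEquicontinuity` (asymptotic local equicontinuity of the renormalised twin
correlators off the plane). -/
def stub_twinEquicontinuity : Prop :=
    ∀ (ρ : ℝ → ℝ) (S : CorrFamily 3), (∀ δ ∈ Set.Ioc (0:ℝ) 1, 0 < ρ δ) →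
      HasPointwiseScalingLimit (criticalCorr 3) ρ S → IsNondegenerateTwoPoint S →
      ∀ J : ℝ, IsSeamThreshold J → ∀ (k : ℕ), ∀ x ∈ NonCoincident 3 k ∩ {w | ∀ i, hR (w i) ≠ 0},
        ∀ ε > (0:ℝ), ∃ t ∈ 𝓝[NonCoincident 3 k ∩ {w | ∀ i, hR (w i) ≠ 0}] x,
          ∀ᶠ δ in 𝓝[>] (0:ℝ), ∀ y ∈ t,
            |ρ δ ^ k * twinCorr J δ k y - ρ δ ^ k * twinCorr J δ k x| ≤ ε

end Sig

/-! ## §4 The registered stubs (the only `sorry`s of this file) -/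

/-- **stub_twoPointTransparency** (BLIND TWO-POINT TRANSPARENCY OF THE TUNED TWIN, pointwise). For
every bulk scaling-limit datum `(ρ, S)` of `criticalCorr 3` with `S₂ > 0` and every continuous
plane-ordering threshold `J` of the (111) reflection twin at `β_c(3)` there is a linear `A`, the
identity on the plane `x₀ + x₁ + x₂ = 0` and preserving the open upper half-space, such that at every
non-coincident pair `w = (w₀, w₁)` with no point on the plane the renormalised twin two-point
function `ρ(δ)² · twinCorr J δ 2 w` converges as `δ → 0⁺` to `S₂` of the pair read through `A` above
the plane. The defect-RG content of the crux at two points (same-side and cross-plane): the tuned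
`θ`-symmetric plane defect is the defect-free fixed point, so the seam is invisible to `⟨σσ⟩` at
macroscopic scale; blind (`∃ A`) so as not to presuppose isotropy — the two-sided `k = 2` instance
is what the route's support `TwinTransfer` uses to pin `A = id`. Open (defect irrelevance at the
n.n. `ℤ³` critical point, `y = 2 − Δ_ε > 0` tuned away by the one seam parameter).
[cite: KrishnanMetlitski2023, §1] [cite: BurkhardtEisenriegler1981] [cite: BrayMoore1977] -/
theorem stub_twoPointTransparency :
    ∀ (ρ : ℝ → ℝ) (S : CorrFamily 3), (∀ δ ∈ Set.Ioc (0:ℝ) 1, 0 < ρ δ) →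
      HasPointwiseScalingLimit (criticalCorr 3) ρ S → IsNondegenerateTwoPoint S →
      ∀ J : ℝ, IsSeamThreshold J →
        ∃ A : E →ₗ[ℝ] E, (∀ v, hR v = 0 → A v = v) ∧ (∀ v, 0 < hR v → 0 < hR (A v)) ∧
          ∀ w ∈ NonCoincident 3 2 ∩ {w | ∀ i, hR (w i) ≠ 0},
            Tendsto (fun δ => ρ δ ^ 2 * twinCorr J δ 2 w) (𝓝[>] (0:ℝ))
              (𝓝 (S 2 (fun i => if hR (w i) ≤ 0 then w i else A (w i)))) := by
  sorry

/-- **stub_allOrderPropagation** (TWO-POINT TRANSPARENCY IS FULL TRANSPARENCY, pointwise). For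
`(ρ, S, J)` as in the crux and every admissible linear `A` (identity on the plane, preserving the
upper half-space): if the renormalised twin two-point functions converge pointwise off the plane to
`S₂` read through `A`, then for every order `k` and every non-coincident configuration `w` off the
plane `ρ(δ)^k · twinCorr J δ k w → S_k(A♯ w)` as `δ → 0⁺`. Defect-CFT reading: `⟨σσ⟩_seam =
⟨σσ⟩_bulk` for all pairs forces, through the bulk OPE `σ × σ`, all even one-point functions of the
seam and its displacement operator to vanish, i.e. the seam is the trivial defect, whose bulk
correlators are the bulk ones at every order; on the lattice a uniqueness statement for the twin's
higher correlators given its two-point asymptotics (random currents / switching), not an RG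
statement. `k = 0`: `1 → S₀ = 1`; odd `k`: `0 → 0`. Open.
[cite: KrishnanMetlitski2023, §1] [cite: DuminilCopinICM2022, §8.1] -/
theorem stub_allOrderPropagation :
    ∀ (ρ : ℝ → ℝ) (S : CorrFamily 3), (∀ δ ∈ Set.Ioc (0:ℝ) 1, 0 < ρ δ) →
      HasPointwiseScalingLimit (criticalCorr 3) ρ S → IsNondegenerateTwoPoint S →
      ∀ J : ℝ, IsSeamThreshold J → ∀ A : E →ₗ[ℝ] E, (∀ v, hR v = 0 → A v = v) →
        (∀ v, 0 < hR v → 0 < hR (A v)) →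
        (∀ w ∈ NonCoincident 3 2 ∩ {w | ∀ i, hR (w i) ≠ 0},
            Tendsto (fun δ => ρ δ ^ 2 * twinCorr J δ 2 w) (𝓝[>] (0:ℝ))
              (𝓝 (S 2 (fun i => if hR (w i) ≤ 0 then w i else A (w i))))) →
        ∀ (k : ℕ), ∀ w ∈ NonCoincident 3 k ∩ {w | ∀ i, hR (w i) ≠ 0},
          Tendsto (fun δ => ρ δ ^ k * twinCorr J δ k w) (𝓝[>] (0:ℝ))
            (𝓝 (S k (fun i => if hR (w i) ≤ 0 then w i else A (w i)))) := by
  sorry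

/-- **stub_twinEquicontinuity** (ASYMPTOTIC LOCAL EQUICONTINUITY OF THE RENORMALISED TWIN
CORRELATORS OFF THE PLANE). For `(ρ, S, J)` as in the crux (`(ρ, S)` only certify that `ρ` is the
critical two-point scale), every order `k`, every non-coincident configuration `x` off the plane and
`ε > 0`, there is a neighbourhood `t` of `x` within the admissible set such that eventually as
`δ → 0⁺`, `|ρ(δ)^k twinCorr J δ k y − ρ(δ)^k twinCorr J δ k x| ≤ ε` for all `y ∈ t`. The regularity
content of the crux ("a twin version of the mirror-Hölder regularity"): no limit is asserted and no
`A` appears; the twin keeps four reflection-positive mirrors (`θ` across the seam plane — FILS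
site-plane form — and the three diagonal lattice mirrors `x_i ↔ x_j` commuting with the surgery)
plus GKS monotonicity in the boxes; `k = 0` and odd `k` are constant families. Open but strictly
softer than the crux (it follows from the crux whenever the limit `S_k ∘ A♯` is continuous on the
admissible set, e.g. `A = id` and `S_k` continuous on `NonCoincident`).
[cite: FrohlichEtAl1978, §3] [cite: DuminilCopinICM2022, §8.4] -/
theorem stub_twinEquicontinuity :
    ∀ (ρ : ℝ → ℝ) (S : CorrFamily 3), (∀ δ ∈ Set.Ioc (0:ℝ) 1, 0 < ρ δ) →
      HasPointwiseScalingLimit (criticalCorr 3) ρ S → IsNondegenerateTwoPoint S →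
      ∀ J : ℝ, IsSeamThreshold J → ∀ (k : ℕ), ∀ x ∈ NonCoincident 3 k ∩ {w | ∀ i, hR (w i) ≠ 0},
        ∀ ε > (0:ℝ), ∃ t ∈ 𝓝[NonCoincident 3 k ∩ {w | ∀ i, hR (w i) ≠ 0}] x,
          ∀ᶠ δ in 𝓝[>] (0:ℝ), ∀ y ∈ t,
            |ρ δ ^ k * twinCorr J δ k y - ρ δ ^ k * twinCorr J δ k x| ≤ ε := by
  sorry

/-! ## §5 The composition (no `sorry`) -/

/-- **The line closes the crux.** Blind two-point transparency (stub 1) supplies the reading map `A`;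
propagation (stub 2) gives pointwise convergence through that `A` at every order; asymptotic local
equicontinuity (stub 3) upgrades pointwise to locally uniform convergence by
`tendstoLocallyUniformlyOn_of_forall_tendsto_of_equicontinuous`; `twinTransparency_iff` concludes the
route decl BY NAME. Hypotheses = the three stub statements BY NAME (`Sig.stub_*`). [folklore] -/
theorem TwinTransparency_of :
    Sig.stub_twoPointTransparency → Sig.stub_allOrderPropagation → Sig.stub_twinEquicontinuity →
      Summit.CriticalPhenomena.Ising3DConformalLimit.Theses.ReflectionTwin.TwinTransparency := by
  intro h2 hprop heq
  rw [twinTransparency_iff]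
  intro ρ S hρ hlim hnd J hJ
  obtain ⟨A, hAfix, hAup, hconv2⟩ := h2 ρ S hρ hlim hnd J hJ
  refine ⟨A, hAfix, hAup, fun k => ?_⟩
  exact tendstoLocallyUniformlyOn_of_forall_tendsto_of_equicontinuous
    (hprop ρ S hρ hlim hnd J hJ A hAfix hAup hconv2 k) (heq ρ S hρ hlim hnd J hJ k)

/-- **The registered stubs discharge the three hypotheses of `TwinTransparency_of` verbatim** (no
`sorry` of its own; it depends on the stubs' `sorry`s until they land — then it IS the proof of the
crux; it also kernel-checks that each `Sig.stub_X` is definitionally the registered signature of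
`stub_X`). [folklore] -/
theorem TwinTransparency_of_stubs :
    Summit.CriticalPhenomena.Ising3DConformalLimit.Theses.ReflectionTwin.TwinTransparency :=
  TwinTransparency_of stub_twoPointTransparency stub_allOrderPropagation stub_twinEquicontinuity

end Summit.CriticalPhenomena.Ising3DConformalLimit.Cruxes.TwinTransparency.Birth

end
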